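import Summits.BirchSwinnertonDyer.BirchSwinnertonDyer.Theorems.PrintX9HowardContainmentOfPrintRescaling
import Literature.NumberTheory.EllipticCurves.ZpExtensionDescentProofs
import Literature.NumberTheory.EllipticCurves.GaloisActionProofs
import HarnessLib

/-!
# `E(K_n)[p] = 0` along a `ℤ_p`-extension when `E[p]` is an irreducible `Γ_K`-module
# (helper for crux `PrintX9.HowardContainmentLightFrameOfPrint`, stmt-BirchSwinnertonDyer-25235, line
# `torsion-depth-light-ofprint`, stub `stub_depthPos_muPart`; discharges hypothesis (iv) of part III)

Summits-side helper (`--supports stmt-BirchSwinnertonDyer-25235`). The rescaling theorems of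
`PrintX9HowardContainmentOfPrintRescaling` (division by `p^a` in `𝔖_p(K_∞)`) need «no `p`-torsion in
`E(K_n)` for every layer `K_n` of the anticyclotomic tower»; CGLS 2022 §3.2 standing hypothesis (h1) is
only `E(K)[p] = 0`, and the light X9 frames carry (irr_K). This file proves the standard remark:

* `fixedGeomPoints_eq_zero_of_smul_eq_zero_of_hasIrreducibleModPGaloisRep`: for `V/K` elliptic with
  `E[p]` an IRREDUCIBLE `Γ_K`-module (`HasIrreducibleModPGaloisRep`), `κ` a `ℤ_p`-extension of the number
  field `K` with topological generator `γ`, and every `n`: a point of `E(K̄)` fixed by `Gal(K̄/K_n)` and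
  killed by `p` is `0`, i.e. `E(K_n)[p] = 0`.
  Proof: `E[p]^{Gal(K̄/K_n)}` is a `Γ_K`-stable subgroup of `E[p]` (normality of `Gal(K̄/K_n)`), so by
  irreducibility it is `0` (done) or all of `E[p]`. In the latter case `Γ_K` acts on `E[p]` through the
  cyclic `p`-group generated by `γ` (`γ^{pⁿ} ∈ Gal(K̄/K_n)`; `Γ_K = ⋃ γᵏ · ker κ · Gal(K̄/K_n)`,
  `ZpDescent.exists_decomp`); a `p`-group acting on the set `E[p]` of cardinality `p²`
  (`card_torsionPoints_eq_sq_holds`) with the fixed point `0` has another fixed point `b ≠ 0`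
  (`IsPGroup.exists_fixed_point_of_prime_dvd_card_of_fixed_point`); then `ℤ b` is a `Γ_K`-stable subgroup
  of order `p`, neither `0` nor `E[p]` — contradicting irreducibility.

* `howardContainment_of_localized_family_of_hasIrreducibleModPGaloisRep`: part III's promotion
  `howardContainment_of_localized_family` with hypothesis (iv) («`E(K_n)[p] = 0` for all `n`») DISCHARGED
  from the frame's (irr_K) `(W.baseChange K).HasIrreducibleModPGaloisRep p` and `κ.IsTopGenerator γ` — the
  remaining hypotheses are `𝔖` finitely generated, `𝔖/ℋ_{F₀}` torsion, a non-torsion element of `ℋ_{F₀}`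
  (all print: CGLS Thm. 4.1.3 rank one + Cornut–Vatsal) and the `p`-localized containment for `F₀`.

HONEST FRAMING: group-action bookkeeping; no named fact; closes nothing by itself; part IV of the rescaling
helper (kernel witness of the cell's FINDING PIN-1: the unpinned `∃ F` layout is `μ`-blind).

References: F. Castella, G. Grossi, J. Lee, C. Skinner, Invent. Math. 227 (2022) §3.2 (h1); B. H. Gross,
LMS LN 153 (1991) §2 (`E(K)[p] = 0` from irreducibility); J.-P. Serre, *Local Fields* IX §1 /
L. Washington, *Cyclotomic Fields* §13.1 (fixed points of `p`-groups; layers of a `ℤ_p`-extension).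
-/

set_option linter.dupNamespace false
set_option autoImplicit false

noncomputable section

open scoped Classical

universe u

open WeierstrassCurve Literature.NumberTheory.EllipticCurves

namespace Summit.BirchSwinnertonDyer.BirchSwinnertonDyer.Theorems.PrintX9Rescaling

section Tower

variable {K : Type u} [Field K] [NumberField K] (V : WeierstrassCurve K) [V.IsElliptic]
  {p : ℕ} [Fact p.Prime] (κ : ZpExtension K p) {γ : Field.absoluteGaloisGroup K}

/-- **`E(K_n)[p] = 0` along a `ℤ_p`-tower when `E[p]` is irreducible over `K`**: a geometric point fixed
by `Gal(K̄/K_n)` and killed by `p` vanishes (fixed points of the cyclic `p`-group `⟨γ⟩` acting on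
`E[p]`, of order `p²`, and irreducibility). [cite: GrossLMS1991, §2 (E(K)[p] = 0 from the irreducibility of E[p])]
[cite: CastellaGrossiLeeSkinner2022, §3.2 (standing hypothesis (h1) E(K)[p] = 0)] -/
theorem fixedGeomPoints_eq_zero_of_smul_eq_zero_of_hasIrreducibleModPGaloisRep
    (hirr : V.HasIrreducibleModPGaloisRep p) (hγ : κ.IsTopGenerator γ) (n : ℕ)
    {P : geomPoints V} (hP : P ∈ V.fixedGeomPoints (κ.layerSubgroup n)) (hpP : (p : ℤ) • P = 0) :
    P = 0 := by
  have hPfix : ∀ σ ∈ κ.layerSubgroup n, σ • P = P := (V.mem_fixedGeomPoints_iff P).1 hP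
  -- the `Gal(K̄/K_n)`-fixed part of `E[p]`, a `Γ_K`-stable subgroup (normality)
  let H₁ : AddSubgroup (geomTorsion V (p : ℤ)) :=
    { carrier := {Q | ∀ σ ∈ κ.layerSubgroup n, σ • Q = Q}
      zero_mem' := fun σ _ ↦ smul_zero σ
      add_mem' := fun {a b} ha hb σ hσ ↦ by rw [smul_add, ha σ hσ, hb σ hσ]
      neg_mem' := fun {a} ha σ hσ ↦ by rw [smul_neg, ha σ hσ] }
  have hH₁stab : ∀ τ : Field.absoluteGaloisGroup K, ∀ Q ∈ H₁, τ • Q ∈ H₁ := by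
    intro τ Q hQ σ hσ
    have hconj : τ⁻¹ * σ * τ ∈ κ.layerSubgroup n := by
      have := (κ.layerSubgroup_normal n).conj_mem σ hσ τ⁻¹
      rwa [inv_inv] at this
    calc σ • τ • Q = τ • ((τ⁻¹ * σ * τ) • Q) := by
          rw [← mul_smul, ← mul_smul, ← mul_assoc, ← mul_assoc, mul_inv_cancel, one_mul]
      _ = τ • Q := by rw [hQ _ hconj]
  let Pm : geomTorsion V (p : ℤ) := ⟨P, (V.mem_geomTorsion_iff (p : ℤ) P).2 hpP⟩
  have hPm : Pm ∈ H₁ := fun σ hσ ↦ Subtype.ext (hPfix σ hσ)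
  rcases hirr H₁ hH₁stab with h0 | htop
  · -- `E[p]^{Gal(K̄/K_n)} = 0`
    have : Pm = 0 := by rw [h0] at hPm; exact hPm
    exact congrArg Subtype.val this
  · -- `E[p]^{Gal(K̄/K_n)} = E[p]`: contradiction with irreducibility
    exfalso
    have hfixU : ∀ σ ∈ κ.layerSubgroup n, ∀ Q : geomTorsion V (p : ℤ), σ • Q = Q := fun σ hσ Q ↦
      (htop ▸ AddSubgroup.mem_top Q : Q ∈ H₁) σ hσ
    -- `#E[p] = p²`
    have hcardM : Nat.card (geomTorsion V (p : ℤ)) = p ^ 2 :=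
      V.card_torsionPoints_eq_sq_holds (AlgebraicClosure K) (n := p)
        (by exact_mod_cast (Fact.out : p.Prime).ne_zero)
    haveI : Finite (geomTorsion V (p : ℤ)) := Nat.finite_of_card_ne_zero (by
      rw [hcardM]; exact pow_ne_zero _ (Fact.out : p.Prime).ne_zero)
    -- `γ^{pⁿ} ∈ Gal(K̄/K_n)` (`κ γ = 1`)
    have hγpn : γ ^ p ^ n ∈ κ.layerSubgroup n := by
      have hγ' : κ γ = Multiplicative.ofAdd 1 := hγ
      rw [ZpExtension.mem_layerSubgroup, map_pow, hγ', ← ofAdd_nsmul, toAdd_ofAdd, nsmul_eq_mul,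
        mul_one, Nat.cast_pow]
    -- the cyclic `p`-group generated by the permutation `γ` of `E[p]`
    have hσpow : (MulAction.toPerm γ : Equiv.Perm (geomTorsion V (p : ℤ))) ^ p ^ n = 1 := by
      rw [← MulAction.toPermHom_apply, ← map_pow]
      ext Q
      rw [MulAction.toPermHom_apply, MulAction.toPerm_apply, Equiv.Perm.coe_one, id_eq]
      exact congrArg Subtype.val
        (hfixU _ hγpn Q)
    have hGp : IsPGroup p (Subgroup.zpowers
        (MulAction.toPerm γ : Equiv.Perm (geomTorsion V (p : ℤ)))) := by
      intro x
      refine ⟨n, Subtype.ext ?_⟩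
      obtain ⟨z, hz⟩ := Subgroup.mem_zpowers_iff.mp x.2
      rw [Subgroup.coe_pow, Subgroup.coe_one, ← hz, ← zpow_natCast, ← zpow_mul, mul_comm, zpow_mul,
        zpow_natCast, hσpow, one_zpow]
    -- `0` is a fixed point; a `p`-group acting on a set of size `p²` has another one
    have h0fix : (0 : geomTorsion V (p : ℤ)) ∈ MulAction.fixedPoints
        (Subgroup.zpowers (MulAction.toPerm γ : Equiv.Perm (geomTorsion V (p : ℤ))))
        (geomTorsion V (p : ℤ)) := by
      refine MulAction.mem_fixedPoints.mpr fun g ↦ ?_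
      obtain ⟨z, hz⟩ := Subgroup.mem_zpowers_iff.mp g.2
      rw [Subgroup.smul_def, Equiv.Perm.smul_def, ← hz, ← MulAction.toPermHom_apply, ← map_zpow,
        MulAction.toPermHom_apply, MulAction.toPerm_apply, smul_zero]
    obtain ⟨b, hbfix, hb0⟩ := hGp.exists_fixed_point_of_prime_dvd_card_of_fixed_point
      (geomTorsion V (p : ℤ)) (by rw [hcardM]; exact dvd_pow_self p two_ne_zero) h0fix
    have hγb : γ • b = b := by
      have := MulAction.mem_fixedPoints.mp hbfix ⟨MulAction.toPerm γ, Subgroup.mem_zpowers _⟩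
      rwa [Subgroup.mk_smul, Equiv.Perm.smul_def, MulAction.toPerm_apply] at this
    have hγk : ∀ k : ℕ, (γ ^ k) • b = b := fun k ↦ by
      induction k with
      | zero => rw [pow_zero, one_smul]
      | succ k ih => rw [pow_succ, mul_smul, hγb, ih]
    -- every element of `Γ_K = ⋃ γᵏ · ker κ · Gal(K̄/K_n)` fixes `b`
    have hall : ∀ τ : Field.absoluteGaloisGroup K, τ • b = b := by
      intro τ
      obtain ⟨k, -, m, hm, u, hu, rfl⟩ :=
        ZpDescent.exists_decomp (κ := κ) hγ (κ.layerSubgroup n) (κ.isOpen_layerSubgroup n) τ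
      rw [mul_smul, mul_smul, hfixU u hu, hfixU m (κ.kerSubgroup_le_layerSubgroup n hm), hγk]
    -- the line `ℤ b ⊆ E[p]` is `Γ_K`-stable, non-zero and of order `p < p²`
    have hLstab : ∀ τ : Field.absoluteGaloisGroup K, ∀ Q ∈ AddSubgroup.zmultiples b,
        τ • Q ∈ AddSubgroup.zmultiples b := by
      intro τ Q hQ
      obtain ⟨z, rfl⟩ := AddSubgroup.mem_zmultiples_iff.mp hQ
      have hz : τ • (z • b) = z • (τ • b) := map_zsmul (DistribSMul.toAddMonoidHom _ τ) z b
      rw [hz, hall]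
      exact AddSubgroup.zsmul_mem _ (AddSubgroup.mem_zmultiples b) z
    rcases hirr (AddSubgroup.zmultiples b) hLstab with hL0 | hLtop
    · have hb : b ∈ AddSubgroup.zmultiples b := AddSubgroup.mem_zmultiples b
      rw [hL0, AddSubgroup.mem_bot] at hb
      exact hb0 hb.symm
    · have hpb : p • b = 0 := Subtype.ext (by
        rw [AddSubmonoidClass.coe_nsmul, ← natCast_zsmul]
        exact (V.mem_geomTorsion_iff (p : ℤ) _).1 b.2)
      have hcardL : Nat.card (AddSubgroup.zmultiples b) = p ^ 2 := by
        rw [hLtop, AddSubgroup.card_top, hcardM]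
      have hdvd : p ^ 2 ∣ p := by
        rw [← hcardL, Nat.card_zmultiples]
        exact addOrderOf_dvd_of_nsmul_eq_zero hpb
      have hp := (Fact.out : p.Prime)
      have hle : p ^ 2 ≤ p := Nat.le_of_dvd hp.pos hdvd
      have hle' : p * p ≤ p * 1 := by rwa [mul_one, ← pow_two]
      have h1 := Nat.le_of_mul_le_mul_left hle' hp.pos
      have h2 := hp.two_le
      omega

end Tower

/-! ## The promotion with hypothesis (iv) discharged from (irr_K) -/

section Frame

open Literature.NumberTheory.EllipticCurves.ModularForms

variable {K : Type u} [Field K] [NumberField K] {N : ℕ} [NeZero N] {W : WeierstrassCurve ℚ}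
  [W.IsElliptic] {p : ℕ} [Fact p.Prime] {κ : ZpExtension K p} {γ : Field.absoluteGaloisGroup K}
  {jbar : AlgebraicClosure K →+* ℂ}

/-- **`μ`-absorption on an (irr_K) frame.** For `E/ℚ` elliptic, `K` a number field with `E[p]` an
irreducible `Γ_K`-module, `κ` a `ℤ_p`-extension of `K` with topological generator `γ`, a `Λ`-adic Selmer
datum `D` with `𝔖 = D.S` finitely generated, a Selmer-dual datum `X`, and ONE Heegner family `F₀` (level
`N`, any parametrisation datum) with `𝔖/ℋ_{F₀}` torsion and `ℋ_{F₀}` containing a non-torsion element: the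
`p`-LOCALIZED containment `(p^m)·I(ℋ_{F₀})² ⊆ char_Λ(X_{Λ-tors})` implies `∃ F, I(ℋ_F)² ⊆ char_Λ(X_{Λ-tors})`
(namely `F = p^m • F₀`). Hypothesis (iv) of `howardContainment_of_localized_family` is discharged by
`fixedGeomPoints_eq_zero_of_smul_eq_zero_of_hasIrreducibleModPGaloisRep`.
[cite: CastellaGrossiLeeSkinner2022, Thm. 4.1.3 ("Moreover") and Remark after Conj. A] [cite: PerrinRiou1987BSMF, §1 p. 405 (H_∞ depends on π)] -/
theorem howardContainment_of_localized_family_of_hasIrreducibleModPGaloisRep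
    (hirr : (W.baseChange K).HasIrreducibleModPGaloisRep p) (hγ : κ.IsTopGenerator γ)
    (D : (W.baseChange K).LambdaAdicSelmerData κ γ) (X : (W.baseChange K).SelmerDualData κ γ)
    (F₀ : HeegnerFamily N W K κ jbar) (m : ℕ)
    (hfin : Module.Finite (IwasawaAlgebra p) D.S)
    (htor : Module.IsTorsion (IwasawaAlgebra p) (D.S ⧸ heegnerModule D F₀))
    (hh : ∃ h ∈ heegnerModule D F₀, ∀ c : IwasawaAlgebra p, c • h = 0 → c = 0)
    (hloc : Ideal.span {(p : IwasawaAlgebra p) ^ m} * heegnerCharIdeal D F₀ ^ 2 ≤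
      Module.charIdeal (IwasawaAlgebra p) (Submodule.torsion (IwasawaAlgebra p) X.X)) :
    ∃ F : HeegnerFamily N W K κ jbar, heegnerCharIdeal D F ^ 2 ≤
      Module.charIdeal (IwasawaAlgebra p) (Submodule.torsion (IwasawaAlgebra p) X.X) :=
  howardContainment_of_localized_family D X F₀ m hfin
    (fun n _ hP hpP ↦ fixedGeomPoints_eq_zero_of_smul_eq_zero_of_hasIrreducibleModPGaloisRep
      (W.baseChange K) κ hirr hγ n hP hpP)
    htor hh hloc

end Frame

end Summit.BirchSwinnertonDyer.BirchSwinnertonDyer.Theorems.PrintX9Rescaling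

end
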